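import Mathlib.MeasureTheory.Integral.MeanInequalities
import Literature.Analysis.FluidPDE.LocalTypeI
import Literature.Analysis.FluidPDE.LocalTypeILscGradientTools
import Literature.Analysis.FunctionSpaces.TestFunctionDensity
import HarnessLib

/-!
# Lower semicontinuity of the dissipation `E` under weak limits of the spatial gradients

Trunk T-FLUID (`Literature/Analysis/FluidPDE`), family NS; proofs layer over
`Literature/Analysis/FluidPDE/LocalTypeI.lean` (Albritton–Barker 2019, Thm 1.1, corrected
rendering `Literature.Analysis.FluidPDE.AlbrittonBarkerTypeICharacterization`). No new
definitions.

In the proof of Thm 1.1 (A–B §3, reverse direction) the Type I bound `𝐈(u) < ∞` of the limit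
`(u, p)` of the rescaled solutions "follows from (3.3)" by lower semicontinuity of the scaled
quantities under the convergences of Lemma 2.2. `LocalTypeILscVelocity.lean` treats `C`, `A`;
`LocalTypeILscPressure.lean` treats `D`; this file treats the dissipation
`E(Q(z, r)) = r⁻¹ ∫_{Q(z,r)} |∇u|²` (`Literature.Analysis.FluidPDE.cknE`), the gradient entering
through weak spatial gradients `G_k = ∇v_k`, `G = ∇u` (`HasWeakSpatialGradientOn`). Strong `L³`
convergence `v_k → u` on the ball makes `∇v_k → ∇u` in the sense of distributions
(`LocalTypeILscGradientTools.lean`), and with the uniform bound `E(Q(z,r); ∇v_k) ≤ M` the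
`L²` norm is weakly lower semicontinuous:

* `cknE_le_of_tendsto_eLpNorm`: if `v_k → u` in `L³(Q₀)`, `Q(z, r) ⊆ Q₀`, `G_k`, `G` are weak
  spatial gradients of `v_k`, `u` on `Q(z, r)` with `∇u ∈ L²(Q(z, r))`, and
  `E(Q(z,r); G_k) ≤ M` for all `k`, then `E(Q(z,r); G) ≤ M`. Proof: package the matrix
  coefficients `⟪G bᵢ, bⱼ⟫` as an `ℝ^{ι × ι}`-valued field `F` (`‖F‖² = |G|²`); for a vector
  test field `Ψ`, `∫ ⟪F, Ψ⟫ = lim_k ∫ ⟪F_k, Ψ⟫ ≤ (r M)^{1/2} ‖Ψ‖_{L²}` (Cauchy–Schwarz); test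
  fields are dense in `L²(Q(z, r))` (`TestFunctionDensity`), so testing along `Ψ_n → F` gives
  `‖F‖_{L²}² ≤ (r M)^{1/2} ‖F‖_{L²}`.

## References

* D. Albritton, T. Barker, *On local Type I singularities of the Navier–Stokes equations and
  Liouville theorems*, J. Math. Fluid Mech. 21 (2019), arXiv:1811.00502, §1 (the quantity `E`)
  and §3 (proof of Thm 1.1, "(3.6) follows from (3.3)").
* H. Brezis, *Functional Analysis, Sobolev Spaces and PDE* (2011), Prop. 3.5 (iii) (weak lower
  semicontinuity of the norm), Cor. 4.23 (density of test functions).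
-/

noncomputable section

open MeasureTheory Set Function Filter Topology TopologicalSpace Metric
open scoped NNReal ENNReal InnerProductSpace RealInnerProductSpace

namespace Literature.Analysis.FluidPDE

variable {E : Type*} [NormedAddCommGroup E] [InnerProductSpace ℝ E] [FiniteDimensional ℝ E]
  [MeasurableSpace E] [BorelSpace E]

/-! ### Main: lower semicontinuity of `E` -/

section Main

variable {Q₀ : Set (ℝ × E)} {r : ℝ} {z : ℝ × E} {v : ℕ → ℝ → E → E} {u : ℝ → E → E}
  {G : ℕ → ℝ → E → E →L[ℝ] E} {Gu : ℝ → E → E →L[ℝ] E} {M : ℝ≥0∞}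

/-- **`E(Q(z,r))` is lower semicontinuous under the convergences of A–B Lemma 2.2**
(Albritton–Barker 2019, §3, the step "(3.6) follows from (3.3)" for the dissipation `E`).
Let `v_k → u` in `L³(Q₀)`, `Q(z, r) ⊆ Q₀`, `r > 0`; let `G_k`, `G` be weak spatial gradients of
`v_k`, `u` on the parabolic ball `Q(z, r)` with `∇u ∈ L²(Q(z, r))`, and suppose
`E(Q(z,r); G_k) = r⁻¹ ∫_{Q(z,r)} |G_k|² ≤ M` for all `k`. Then `E(Q(z,r); G) ≤ M`: the
gradients converge in the sense of distributions (`setIntegral_inner_coeffVec_eq`,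
`tendsto_integral_mul_inner_of_tendsto_eLpNorm`), the pairings with a test field `Ψ` are
bounded by `(r M)^{1/2} ‖Ψ‖_{L²}` (Cauchy–Schwarz), and test fields are dense in `L²(Q(z, r))`
(`Literature.Analysis.FunctionSpaces.exists_isTestFunctionOn_tendsto_eLpNorm_sub`), whence
`‖G‖_{L²(Q(z,r))}² ≤ r M` (weak lower semicontinuity of the norm, Brezis Prop. 3.5 (iii)).
[cite: AlbrittonBarker2019, §3] -/
theorem cknE_le_of_tendsto_eLpNorm (hr : 0 < r) (hQ : parabolicCylinder r z ⊆ Q₀)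
    (hG : ∀ k, HasWeakSpatialGradientOn (parabolicCylinderOpens r z) (v k) (G k))
    (hGu : HasWeakSpatialGradientOn (parabolicCylinderOpens r z) u Gu)
    (hGu2 : ∫⁻ w in parabolicCylinder r z, ENNReal.ofReal (frobeniusNormSq (Gu w.1 w.2)) < ∞)
    (hconv : Tendsto (fun k => eLpNorm (uncurry (v k) - uncurry u) 3 (volume.restrict Q₀))
      atTop (𝓝 0))
    (hbound : ∀ k, cknE r z (G k) ≤ M) : cknE r z Gu ≤ M := by
  rcases eq_or_ne M ⊤ with rfl | hM
  · exact le_top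
  set Ω : Opens (ℝ × E) := parabolicCylinderOpens r z with hΩ
  have hΩQ : (Ω : Set (ℝ × E)) ⊆ Q₀ := hQ
  set μ' : Measure (ℝ × E) := volume.restrict (parabolicCylinder r z) with hμ'
  have hr0 : ENNReal.ofReal r ≠ 0 := (ENNReal.ofReal_pos.2 hr).ne'
  have hr0' : ENNReal.ofReal r ≠ ∞ := ENNReal.ofReal_ne_top
  set A := ENNReal.ofReal r * M with hA
  have hAtop : A ≠ ⊤ := ENNReal.mul_ne_top hr0' hM
  have hEdef : ∀ H : ℝ → E → E →L[ℝ] E, cknE r z H =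
      (ENNReal.ofReal r)⁻¹ * ∫⁻ w, ENNReal.ofReal (frobeniusNormSq (H w.1 w.2)) ∂μ' := fun H => rfl
  have hGk : ∀ k, ∫⁻ w, ENNReal.ofReal (frobeniusNormSq (G k w.1 w.2)) ∂μ' ≤ A := fun k =>
    (ENNReal.inv_mul_le_iff hr0 hr0').1 (by rw [← hEdef]; exact hbound k)
  -- the coefficient fields
  set b := stdOrthonormalBasis ℝ E with hb
  set cv : (E →L[ℝ] E) → EuclideanSpace ℝ (Fin (Module.finrank ℝ E) × Fin (Module.finrank ℝ E)) :=
    fun L => WithLp.toLp 2 fun ij => ⟪L (b ij.1), b ij.2⟫ with hcv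
  have hcvc : Continuous cv := by
    rw [hcv]
    fun_prop
  have hcvn : ∀ L, ‖cv L‖ₑ ^ (2 : ℝ) = ENNReal.ofReal (frobeniusNormSq L) := fun L => by
    rw [← ofReal_norm, ENNReal.ofReal_rpow_of_nonneg (norm_nonneg _) (by norm_num), Real.rpow_two,
      hcv, norm_sq_coeffVec_std]
  set F : ℝ × E → EuclideanSpace ℝ (Fin (Module.finrank ℝ E) × Fin (Module.finrank ℝ E)) :=
    fun w => cv (Gu w.1 w.2) with hF
  set Fk : ℕ → ℝ × E → EuclideanSpace ℝ (Fin (Module.finrank ℝ E) × Fin (Module.finrank ℝ E)) :=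
    fun k w => cv (G k w.1 w.2) with hFk
  have hF_enorm : ∀ w, ‖F w‖ₑ ^ (2 : ℝ) = ENNReal.ofReal (frobeniusNormSq (Gu w.1 w.2)) :=
    fun w => hcvn (Gu w.1 w.2)
  have hFk_enorm : ∀ k w, ‖Fk k w‖ₑ ^ (2 : ℝ) = ENNReal.ofReal (frobeniusNormSq (G k w.1 w.2)) :=
    fun k w => hcvn (G k w.1 w.2)
  have hFm : AEStronglyMeasurable F μ' :=
    hcvc.comp_aestronglyMeasurable hGu.locallyIntegrableOn_grad.aestronglyMeasurable
  have hFkm : ∀ k, AEStronglyMeasurable (Fk k) μ' := fun k =>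
    hcvc.comp_aestronglyMeasurable (hG k).locallyIntegrableOn_grad.aestronglyMeasurable
  -- `L²` bookkeeping
  have h2eq : ∀ Φ : ℝ × E → EuclideanSpace ℝ (Fin (Module.finrank ℝ E) × Fin (Module.finrank ℝ E)),
      eLpNorm Φ 2 μ' = (∫⁻ w, ‖Φ w‖ₑ ^ (2 : ℝ) ∂μ') ^ (1 / 2 : ℝ) := fun Φ => by
    rw [eLpNorm_eq_lintegral_rpow_enorm_toReal two_ne_zero ENNReal.ofNat_ne_top,
      ENNReal.toReal_ofNat]
  set N := ∫⁻ w, ‖F w‖ₑ ^ (2 : ℝ) ∂μ' with hN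
  have hNeq : N = ∫⁻ w, ENNReal.ofReal (frobeniusNormSq (Gu w.1 w.2)) ∂μ' :=
    lintegral_congr hF_enorm
  have hNtop : N ≠ ⊤ := by rw [hNeq]; exact hGu2.ne
  have hNk : ∀ k, ∫⁻ w, ‖Fk k w‖ₑ ^ (2 : ℝ) ∂μ' ≤ A := fun k => by
    rw [lintegral_congr (hFk_enorm k)]; exact hGk k
  have hFN : eLpNorm F 2 μ' = N ^ (1 / 2 : ℝ) := h2eq F
  have hFmem : MemLp F 2 μ' :=
    ⟨hFm, by rw [hFN]; exact ENNReal.rpow_lt_top_of_nonneg (by norm_num) hNtop⟩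
  have hFkN : ∀ k, eLpNorm (Fk k) 2 μ' ≤ A ^ (1 / 2 : ℝ) := fun k => by
    rw [h2eq]; exact ENNReal.rpow_le_rpow (hNk k) (by norm_num)
  -- Cauchy–Schwarz for pairings
  have hCS :
      ∀ Φ₁ Φ₂ : ℝ × E → EuclideanSpace ℝ (Fin (Module.finrank ℝ E) × Fin (Module.finrank ℝ E)),
      AEStronglyMeasurable Φ₁ μ' → AEStronglyMeasurable Φ₂ μ' →
      ‖∫ w, ⟪Φ₁ w, Φ₂ w⟫ ∂μ'‖ₑ ≤ eLpNorm Φ₁ 2 μ' * eLpNorm Φ₂ 2 μ' := by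
    intro Φ₁ Φ₂ h₁ h₂
    refine (enorm_integral_le_lintegral_enorm _).trans ?_
    have hH := ENNReal.lintegral_mul_le_Lp_mul_Lq μ'
      (Real.holderConjugate_iff.2 ⟨by norm_num, by norm_num⟩ : (2 : ℝ).HolderConjugate 2)
      h₁.aemeasurable.enorm h₂.aemeasurable.enorm
    simp only [Pi.mul_apply] at hH
    calc ∫⁻ w, ‖⟪Φ₁ w, Φ₂ w⟫‖ₑ ∂μ' ≤ ∫⁻ w, ‖Φ₁ w‖ₑ * ‖Φ₂ w‖ₑ ∂μ' := by
          refine lintegral_mono fun w => ?_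
          rw [← ofReal_norm, ← ofReal_norm, ← ofReal_norm, ← ENNReal.ofReal_mul (norm_nonneg _)]
          exact ENNReal.ofReal_le_ofReal (norm_inner_le_norm _ _)
      _ ≤ (∫⁻ w, ‖Φ₁ w‖ₑ ^ (2 : ℝ) ∂μ') ^ (1 / 2 : ℝ) *
            (∫⁻ w, ‖Φ₂ w‖ₑ ^ (2 : ℝ) ∂μ') ^ (1 / 2 : ℝ) := hH
      _ = eLpNorm Φ₁ 2 μ' * eLpNorm Φ₂ 2 μ' := by rw [h2eq, h2eq]
  -- integrability of pairings of `L²` fields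
  have hint :
      ∀ Φ₁ Φ₂ : ℝ × E → EuclideanSpace ℝ (Fin (Module.finrank ℝ E) × Fin (Module.finrank ℝ E)),
      MemLp Φ₁ 2 μ' → MemLp Φ₂ 2 μ' → Integrable (fun w => ⟪Φ₁ w, Φ₂ w⟫) μ' := by
    intro Φ₁ Φ₂ h₁ h₂
    refine Integrable.mono' (h₁.norm.integrable_mul h₂.norm) (h₁.1.inner h₂.1)
      (ae_of_all _ fun w => ?_)
    exact norm_inner_le_norm _ _
  -- Step 1: pairings with a test field converge
  have hpair : ∀ Ψ : ℝ × E → EuclideanSpace ℝ (Fin (Module.finrank ℝ E) × Fin (Module.finrank ℝ E)),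
      FunctionSpaces.IsTestFunctionOn Ω Ψ →
      Tendsto (fun k => ∫ w, ⟪Fk k w, Ψ w⟫ ∂μ') atTop (𝓝 (∫ w, ⟪F w, Ψ w⟫ ∂μ')) := by
    intro Ψ hΨ
    have ek : ∀ k, ∫ w, ⟪Fk k w, Ψ w⟫ ∂μ' =
        -∑ ij : Fin (Module.finrank ℝ E) × Fin (Module.finrank ℝ E),
        ∫ w : ℝ × E, fderiv ℝ (fun x => Ψ (w.1, x) ij) w.2 (b ij.1) * ⟪v k w.1 w.2, b ij.2⟫ :=
      fun k => setIntegral_inner_coeffVec_eq (hG k) b hΨ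
    have e : ∫ w, ⟪F w, Ψ w⟫ ∂μ' = -∑ ij : Fin (Module.finrank ℝ E) × Fin (Module.finrank ℝ E),
        ∫ w : ℝ × E, fderiv ℝ (fun x => Ψ (w.1, x) ij) w.2 (b ij.1) * ⟪u w.1 w.2, b ij.2⟫ :=
      setIntegral_inner_coeffVec_eq hGu b hΨ
    simp_rw [ek, e]
    refine Tendsto.neg (tendsto_finsetSum _ fun ij _ => ?_)
    obtain ⟨hθc, hθcs, hθΩ⟩ := fderiv_coord_weight hΨ ij (b ij.1)
    exact tendsto_integral_mul_inner_of_tendsto_eLpNorm hΩQ (fun k => (hG k).locallyIntegrableOn)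
      hGu.locallyIntegrableOn hconv hθc hθcs hθΩ (b ij.2)
  -- Step 2: the bound survives the limit in `k`
  have hlim : ∀ Ψ : ℝ × E → EuclideanSpace ℝ (Fin (Module.finrank ℝ E) × Fin (Module.finrank ℝ E)),
      FunctionSpaces.IsTestFunctionOn Ω Ψ →
      ‖∫ w, ⟪F w, Ψ w⟫ ∂μ'‖ₑ ≤ A ^ (1 / 2 : ℝ) * eLpNorm Ψ 2 μ' := by
    intro Ψ hΨ
    have hΨm : AEStronglyMeasurable Ψ μ' := hΨ.contDiff.continuous.aestronglyMeasurable
    refine le_of_tendsto' (hpair Ψ hΨ).enorm fun k => ?_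
    exact (hCS _ _ (hFkm k) hΨm).trans (mul_le_mul' (hFkN k) le_rfl)
  -- Step 3: density of test fields in `L²(Q(z, r))`
  obtain ⟨Ψ, hΨ, hΨlim⟩ := FunctionSpaces.exists_isTestFunctionOn_tendsto_eLpNorm_sub Ω
    (μ := volume) (p := 2) (by norm_num) (by norm_num) hFmem
  have hΨmem : ∀ n, MemLp (Ψ n) 2 μ' := fun n =>
    ((hΨ n).contDiff.continuous.memLp_of_hasCompactSupport (hΨ n).hasCompactSupport).restrict _
  -- (a) `∫ ⟪F, Ψ n⟫ → ∫ ⟪F, F⟫`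
  have ha : Tendsto (fun n => ∫ w, ⟪F w, Ψ n w⟫ ∂μ') atTop (𝓝 (∫ w, ⟪F w, F w⟫ ∂μ')) := by
    rw [tendsto_iff_edist_tendsto_0]
    have hb : ∀ n, edist (∫ w, ⟪F w, Ψ n w⟫ ∂μ') (∫ w, ⟪F w, F w⟫ ∂μ') ≤
        eLpNorm F 2 μ' * eLpNorm (F - Ψ n) 2 μ' := by
      intro n
      rw [edist_eq_enorm_sub, ← integral_sub (hint _ _ hFmem (hΨmem n)) (hint _ _ hFmem hFmem)]
      have e : (fun w => ⟪F w, Ψ n w⟫ - ⟪F w, F w⟫) = fun w => ⟪F w, (Ψ n - F) w⟫ := by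
        funext w; rw [Pi.sub_apply, inner_sub_right]
      rw [e, eLpNorm_sub_comm]
      exact hCS _ _ hFm ((hΨmem n).1.sub hFm)
    have h0 : Tendsto (fun n => eLpNorm F 2 μ' * eLpNorm (F - Ψ n) 2 μ') atTop (𝓝 0) := by
      have h := ENNReal.Tendsto.const_mul hΨlim (Or.inr hFmem.eLpNorm_ne_top)
      rwa [mul_zero] at h
    exact tendsto_of_tendsto_of_tendsto_of_le_of_le tendsto_const_nhds h0 (fun n => bot_le) hb
  -- (b) `‖∫ ⟪F, F⟫‖ₑ = N`
  have hNint : ‖∫ w, ⟪F w, F w⟫ ∂μ'‖ₑ = N := by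
    have e : (fun w => ⟪F w, F w⟫) = fun w => ‖F w‖ ^ 2 := by
      funext w; exact real_inner_self_eq_norm_sq (F w)
    have hnn : 0 ≤ ∫ w, ⟪F w, F w⟫ ∂μ' := by
      rw [e]; exact integral_nonneg fun w => by positivity
    rw [Real.enorm_eq_ofReal hnn, e, ofReal_integral_eq_lintegral_ofReal
      (by rw [← e]; exact hint _ _ hFmem hFmem) (ae_of_all _ fun w => by positivity)]
    refine lintegral_congr fun w => ?_
    rw [← ofReal_norm, ENNReal.ofReal_rpow_of_nonneg (norm_nonneg _) (by norm_num), Real.rpow_two]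
  -- (c) the bound along the density sequence and its limit: `N ≤ A^{1/2} N^{1/2}`
  have hkey : N ≤ A ^ (1 / 2 : ℝ) * N ^ (1 / 2 : ℝ) := by
    have hbn : ∀ n, ‖∫ w, ⟪F w, Ψ n w⟫ ∂μ'‖ₑ ≤
        A ^ (1 / 2 : ℝ) * (eLpNorm F 2 μ' + eLpNorm (F - Ψ n) 2 μ') := by
      intro n
      refine (hlim (Ψ n) (hΨ n)).trans ?_
      gcongr
      calc eLpNorm (Ψ n) 2 μ' = eLpNorm (F - (F - Ψ n)) 2 μ' := by rw [sub_sub_cancel]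
        _ ≤ eLpNorm F 2 μ' + eLpNorm (F - Ψ n) 2 μ' :=
            eLpNorm_sub_le hFm (hFm.sub (hΨmem n).1) one_le_two
    have hR : Tendsto (fun n => A ^ (1 / 2 : ℝ) * (eLpNorm F 2 μ' + eLpNorm (F - Ψ n) 2 μ')) atTop
        (𝓝 (A ^ (1 / 2 : ℝ) * eLpNorm F 2 μ')) := by
      have h1 : Tendsto (fun n => eLpNorm F 2 μ' + eLpNorm (F - Ψ n) 2 μ') atTop
          (𝓝 (eLpNorm F 2 μ')) := by
        have h := (tendsto_const_nhds (x := eLpNorm F 2 μ') (f := (atTop : Filter ℕ))).add hΨlim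
        rwa [add_zero] at h
      exact ENNReal.Tendsto.const_mul h1
        (Or.inr (ENNReal.rpow_ne_top_of_nonneg (by norm_num) hAtop))
    have h := le_of_tendsto_of_tendsto' ha.enorm hR hbn
    rwa [hNint, hFN] at h
  -- (d) `N ≤ A`
  have hNA : N ≤ A := by
    rcases eq_or_ne N 0 with hN0 | hN0
    · rw [hN0]; exact zero_le
    have h12 : N ^ (1 / 2 : ℝ) ≠ 0 := by
      intro h
      rcases ENNReal.rpow_eq_zero_iff.1 h with ⟨h0, -⟩ | ⟨-, hneg⟩
      · exact hN0 h0
      · norm_num at hneg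
    have h12' : N ^ (1 / 2 : ℝ) ≠ ∞ := ENNReal.rpow_ne_top_of_nonneg (by norm_num) hNtop
    have h1 : N ^ (1 / 2 : ℝ) ≤ A ^ (1 / 2 : ℝ) := by
      have e : N ^ (1 / 2 : ℝ) * N ^ (1 / 2 : ℝ) = N := by
        rw [← ENNReal.rpow_add _ _ hN0 hNtop]; norm_num
      rw [← ENNReal.mul_le_mul_iff_left h12 h12', e]
      exact hkey
    have := ENNReal.rpow_le_rpow h1 (by norm_num : (0 : ℝ) ≤ 2)
    rwa [← ENNReal.rpow_mul, ← ENNReal.rpow_mul, show (1 / 2 : ℝ) * 2 = 1 by norm_num,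
      ENNReal.rpow_one, ENNReal.rpow_one] at this
  rw [hEdef, ← hNeq]
  exact (ENNReal.inv_mul_le_iff hr0 hr0').2 hNA

end Main

end Literature.Analysis.FluidPDE
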